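import Mathlib
import Literature.NumberTheory.Transcendental.KZCalculus

/-!
# Line `scaling_chart` for item `StarDiscScaling` (stmt-KontsevichZagierPeriods-17842, route HardSphereVirial)

`StarDiscScaling` (crux-strategist piece 1/3 of `StarFourDisc`, support): `[K₄] − 6·[B̄ × L × L, |p|⁴] + 6·[B̄ × Far, |p|⁴]
∈ KZ.relations` for the complete-star representation of `B₄` for hard discs — the move-by-move shadow of the PROVED
value computation `Literature.MathematicalPhysics.StatisticalMechanics.HardDiscB4Volume` (`volume_star_eq_six_mul`,
`mem_P0_iff`, `volume_slice_P0`, `volume_P0`, `volume_starProd`: `V(K₄) = 6·vol P₀ = 6·(π/3)·vol Std`):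

* `ArgmaxSixfold` — `[K₄] ≡ 6·[P₀]`, `P₀ = {bond 0 = |r₂|² is the strict maximum of the six squared bonds}`: rule (1a) into the
  six argmax pieces and the ties (null: `HardDiscB4Volume.volume_tie_eq_zero`; a null-domain representation is itself a
  relation, `KZ.of_mem_relations_of_volume_eq_zero`), then the relabelling symmetries of
  `HardDiscB4Volume.exists_bond_symmetry` (permutations of `r₂,r₃,r₄` and the re-rooting `(r₂,r₃,r₄) ↦ (r₂−r₃, r₂, r₂−r₄)`,
  `ℚ`-linear, `|det| = 1`) as rule-(2) moves `[Pᵢ] ≡ [P₀]`;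
* `ScalingChart`  — ONE rule-(2) move: `Φ(p,y,z) = (p, p·y, p·z)` (complex multiplication on both factors; polynomial,
  `|det Φ′| = |p|⁴`, injective on `p ≠ 0`, `u ↦ z/(…)` recovers the inverse) maps `(B ∖ 0) × Std` onto `P₀`
  (`HardDiscB4Volume.mem_P0_iff`), `Std = {(y,z) ∈ L × L | |y − z| < 1}`: `[P₀, 1] ≡ [(B∖0) × Std, |p|⁴]`;
* `CylinderSplit` — rule (1a): `B̄ × (L×L) = (B̄ × Std) ⊔ (B̄ × Far)` and `(B∖0) × Std` differs from `B̄ × Std` by the null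
  sets `p = 0`, `|p| = 1`; honest cylinders `qL`, `qF` exist (`KZ.IntegralRep.ofRational`).

Composition `StarDiscScaling_of` (kernel-checked, sorries only in the stubs):
`[r] − 6qL + 6qF = ([r] − 6r₀) + 6(r₀ − q) + 6(q − qL + qF)`.
-/

namespace Summit.KontsevichZagierPeriods.KontsevichZagierPeriods.Cruxes.StarDiscScaling.ScalingChartLine

open Literature.NumberTheory.Transcendental

/-- Stub proposition 1 — ARGMAX SIXFOLD `[K₄] ≡ 6·[P₀]`. [cite: KontsevichZagier2001, §1.2 rules (1), (2)] -/
def ArgmaxSixfold : Prop :=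
  ∀ (r : Literature.NumberTheory.Transcendental.KZ.IntegralRep 6), r.domain = {x | x 0 ^ 2 + x 1 ^ 2 < 1 ∧ x 2 ^ 2 + x 3 ^ 2 < 1 ∧ x 4 ^ 2 + x 5 ^ 2 < 1 ∧ (x 0 - x 2) ^ 2 + (x 1 - x 3) ^ 2 < 1 ∧ (x 0 - x 4) ^ 2 + (x 1 - x 5) ^ 2 < 1 ∧ (x 2 - x 4) ^ 2 + (x 3 - x 5) ^ 2 < 1} → (∀ x ∈ r.domain, r.integrand x = 1) → ∃ (r₀ : Literature.NumberTheory.Transcendental.KZ.IntegralRep 6), r₀.domain = {x | x 0 ^ 2 + x 1 ^ 2 < 1 ∧ x 2 ^ 2 + x 3 ^ 2 < x 0 ^ 2 + x 1 ^ 2 ∧ x 4 ^ 2 + x 5 ^ 2 < x 0 ^ 2 + x 1 ^ 2 ∧ (x 0 - x 2) ^ 2 + (x 1 - x 3) ^ 2 < x 0 ^ 2 + x 1 ^ 2 ∧ (x 0 - x 4) ^ 2 + (x 1 - x 5) ^ 2 < x 0 ^ 2 + x 1 ^ 2 ∧ (x 2 - x 4) ^ 2 + (x 3 - x 5) ^ 2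 < x 0 ^ 2 + x 1 ^ 2} ∧ (∀ x ∈ r₀.domain, r₀.integrand x = 1) ∧ Literature.NumberTheory.Transcendental.KZ.of r - (6 : ℤ) • Literature.NumberTheory.Transcendental.KZ.of r₀ ∈ Literature.NumberTheory.Transcendental.KZ.relations

/-- Stub proposition 2 — THE SCALING CHART `[P₀, 1] ≡ [(B∖0) × Std, |p|⁴]`. [cite: KontsevichZagier2001, §1.2 rule (2)] -/
def ScalingChart : Prop :=
  ∀ (r₀ : Literature.NumberTheory.Transcendental.KZ.IntegralRep 6), r₀.domain = {x | x 0 ^ 2 + x 1 ^ 2 < 1 ∧ x 2 ^ 2 + x 3 ^ 2 < x 0 ^ 2 + x 1 ^ 2 ∧ x 4 ^ 2 + x 5 ^ 2 < x 0 ^ 2 + x 1 ^ 2 ∧ (x 0 - x 2) ^ 2 + (x 1 - x 3) ^ 2 < x 0 ^ 2 + x 1 ^ 2 ∧ (x 0 - x 4) ^ 2 + (x 1 - x 5) ^ 2 < x 0 ^ 2 + x 1 ^ 2 ∧ (x 2 - x 4) ^ 2 + (x 3 - x 5) ^ 2 < x 0 ^ 2 + x 1 ^ 2} → (∀ x ∈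 r₀.domain, r₀.integrand x = 1) → ∃ (q : Literature.NumberTheory.Transcendental.KZ.IntegralRep 6), q.domain = {x | (0 < x 0 ^ 2 + x 1 ^ 2 ∧ x 0 ^ 2 + x 1 ^ 2 < 1) ∧ (x 2 ^ 2 + x 3 ^ 2 < 1 ∧ (x 2 - 1) ^ 2 + x 3 ^ 2 < 1) ∧ (x 4 ^ 2 + x 5 ^ 2 < 1 ∧ (x 4 - 1) ^ 2 + x 5 ^ 2 < 1) ∧ (x 2 - x 4) ^ 2 + (x 3 - x 5) ^ 2 < 1} ∧ (∀ x ∈ q.domain, q.integrand x = (x 0 ^ 2 + x 1 ^ 2) ^ 2) ∧ Literature.NumberTheory.Transcendental.KZ.of r₀ - Literature.NumberTheory.Transcendental.KZ.of q ∈ Literature.NumberTheory.Transcendental.KZ.relations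

/-- Stub proposition 3 — CYLINDER SPLIT `[(B∖0) × Std, |p|⁴] ≡ [B̄ × L × L, |p|⁴] − [B̄ × Far, |p|⁴]`.
[cite: KontsevichZagier2001, §1.2 rule (1)] -/
def CylinderSplit : Prop :=
  ∀ (q : Literature.NumberTheory.Transcendental.KZ.IntegralRep 6), q.domain = {x | (0 < x 0 ^ 2 + x 1 ^ 2 ∧ x 0 ^ 2 + x 1 ^ 2 < 1) ∧ (x 2 ^ 2 + x 3 ^ 2 < 1 ∧ (x 2 - 1) ^ 2 + x 3 ^ 2 < 1) ∧ (x 4 ^ 2 + x 5 ^ 2 < 1 ∧ (x 4 - 1) ^ 2 + x 5 ^ 2 < 1) ∧ (x 2 - x 4) ^ 2 + (x 3 - x 5) ^ 2 < 1} → (∀ x ∈ q.domain, q.integrand x = (x 0 ^ 2 + x 1 ^ 2) ^ 2) → ∃ (qL qF : Literature.NumberTheory.Transcendental.KZ.IntegralRep 6), qL.domain = {x | x 0 ^ 2 + x 1 ^ 2 ≤ 1 ∧ (x 2 ^ 2 + x 3 ^ 2 < 1 ∧ (x 2 - 1) ^ 2 + x 3 ^ 2 < 1) ∧ (x 4 ^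 2 + x 5 ^ 2 < 1 ∧ (x 4 - 1) ^ 2 + x 5 ^ 2 < 1)} ∧ (∀ x ∈ qL.domain, qL.integrand x = (x 0 ^ 2 + x 1 ^ 2) ^ 2) ∧ qF.domain = {x | x 0 ^ 2 + x 1 ^ 2 ≤ 1 ∧ (x 2 ^ 2 + x 3 ^ 2 < 1 ∧ (x 2 - 1) ^ 2 + x 3 ^ 2 < 1) ∧ (x 4 ^ 2 + x 5 ^ 2 < 1 ∧ (x 4 - 1) ^ 2 + x 5 ^ 2 < 1) ∧ 1 ≤ (x 2 - x 4) ^ 2 + (x 3 - x 5) ^ 2} ∧ (∀ x ∈ qF.domain, qF.integrand x = (x 0 ^ 2 + x 1 ^ 2) ^ 2) ∧ Literature.NumberTheory.Transcendental.KZ.of q - Literature.NumberTheory.Transcendental.KZ.of qL + Literature.NumberTheory.Transcendental.KZ.of qF ∈ Literature.NumberTheory.Transcendental.KZ.relations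

/-- LOCAL COPY of the route decl `Summit.KontsevichZagierPeriods.KontsevichZagierPeriods.Theses.HardSphereVirial.StarDiscScaling`
(stmt-1784x; identical body). PUBLISHED IN DRAFT FORM because the Lean farm was incoherent for `Theses.HardSphereVirial` (route rev 6)
when this line was written; TO FINALISE: import the route file, replace `StarDiscScaling_local` by the route decl in `StarDiscScaling_of`, and run
`ledger skeleton check <this file> --crux <item>` — the composition is unchanged (kernel-checked here against the copy). -/
def StarDiscScaling_local : Prop :=
  ∀ (r : Literature.NumberTheory.Transcendental.KZ.IntegralRep 6), r.domain = {x | x 0 ^ 2 + x 1 ^ 2 < 1 ∧ x 2 ^ 2 + x 3 ^ 2 < 1 ∧ x 4 ^ 2 + x 5 ^ 2 < 1 ∧ (x 0 - x 2) ^ 2 + (x 1 - x 3) ^ 2 < 1 ∧ (x 0 - x 4) ^ 2 + (x 1 - x 5) ^ 2 < 1 ∧ (x 2 - x 4) ^ 2 + (x 3 - x 5) ^ 2 < 1} → (∀ x ∈ r.domain, r.integrand x = 1) → ∃ (qL qF : Literature.NumberTheory.Transcendental.KZ.IntegralRep 6), qL.domain = {x | x 0 ^ 2 + x 1 ^ 2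 ≤ 1 ∧ (x 2 ^ 2 + x 3 ^ 2 < 1 ∧ (x 2 - 1) ^ 2 + x 3 ^ 2 < 1) ∧ (x 4 ^ 2 + x 5 ^ 2 < 1 ∧ (x 4 - 1) ^ 2 + x 5 ^ 2 < 1)} ∧ (∀ x ∈ qL.domain, qL.integrand x = (x 0 ^ 2 + x 1 ^ 2) ^ 2) ∧ qF.domain = {x | x 0 ^ 2 + x 1 ^ 2 ≤ 1 ∧ (x 2 ^ 2 + x 3 ^ 2 < 1 ∧ (x 2 - 1) ^ 2 + x 3 ^ 2 < 1) ∧ (x 4 ^ 2 + x 5 ^ 2 < 1 ∧ (x 4 - 1) ^ 2 + x 5 ^ 2 < 1) ∧ 1 ≤ (x 2 - x 4) ^ 2 + (x 3 - x 5) ^ 2} ∧ (∀ x ∈ qF.domain, qF.integrand x = (x 0 ^ 2 + x 1 ^ 2) ^ 2) ∧ Literature.NumberTheory.Transcendental.KZ.of r - (6 : ℤ) • Literature.NumberTheory.Transcendental.KZ.of qL + (6 : ℤ) • Literature.NumberTheory.Transcendental.KZ.of qF ∈ Literature.NumberTheory.Transcendental.KZ.relations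

/-- **Stub 1.** [cite: KontsevichZagier2001, §1.2] -/
theorem stub_argmaxSixfold : ArgmaxSixfold := by
  sorry

/-- **Stub 2.** [cite: KontsevichZagier2001, §1.2 rule (2)] -/
theorem stub_scalingChart : ScalingChart := by
  sorry

/-- **Stub 3.** [cite: KontsevichZagier2001, §1.2 rule (1)] -/
theorem stub_cylinderSplit : CylinderSplit := by
  sorry

/-- **Composition**: the three stubs imply the item `StarDiscScaling` BY NAME:
`[r] − 6qL + 6qF = ([r] − 6r₀) + 6(r₀ − q) + 6(q − qL + qF)`. [cite: KontsevichZagier2001, §1.2] -/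
theorem StarDiscScaling_of :
    StarDiscScaling_local := by
  intro r hr hr1
  obtain ⟨r₀, hr₀, hr₀1, h1⟩ := stub_argmaxSixfold r hr hr1
  obtain ⟨q, hq, hq1, h2⟩ := stub_scalingChart r₀ hr₀ hr₀1
  obtain ⟨qL, qF, hqL, hqL1, hqF, hqF1, h3⟩ := stub_cylinderSplit q hq hq1
  refine ⟨qL, qF, hqL, hqL1, hqF, hqF1, ?_⟩
  have hsum := KZ.relations.add_mem (KZ.relations.add_mem h1 (KZ.relations.zsmul_mem h2 6)) (KZ.relations.zsmul_mem h3 6)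
  convert hsum using 1
  module

end Summit.KontsevichZagierPeriods.KontsevichZagierPeriods.Cruxes.StarDiscScaling.ScalingChartLine
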